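import Mathlib
import Literature.NumberTheory.LFunctions.Zhang2022.Section12Top1225ExFrontEnd
import Literature.NumberTheory.LFunctions.Zhang2022.Section8FrontEnd44Reduction
import Literature.NumberTheory.LFunctions.Zhang2022.Section9GatheringCore
import HarnessLib

/-!
# Zhang (2022) §12 (12.13), exact reading: the top range of `S_j(𝐚₁₂,𝐚₂₅)` — the core range
# bookkeeping ("by lemma 8.2, 8.3 and 12.3 … + o(α)", the GATHERED form)

Topic `Literature/NumberTheory/LFunctions/Zhang2022` (Landau–Siegel audit tree; verdict-neutral).
Y. Zhang, *Discrete mean estimates and the Landau–Siegel zero*, arXiv:2211.02515v1 (2022)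
[Zhang2022LandauSiegel] — **an unrefereed manuscript under adjudication; theorem-only file, nothing here
bears on its Theorems 1–2 or on Landau–Siegel zeros** (lane ZHANG-L, WP12, seat zl-w12-p6; node
`Typed.Sec12C.Top1225Ex`, RT-02). Second layer, the §12 twin of `Section8FrontEnd44Reduction.core` /
`Section9GatheringCore.core9Rel`:

* `core_top` — for fixed `D` (`𝓛 ≥ 5`), real primitive `χ`, `j`: IF the two Lemma 8.2 applications
  (`M₃ = L′𝔣_{j6}(P₃/dr)/log P₃ + O(C₁𝓛⁻¹⁵)` for `dr < P₃/T`, `M₂ = L′𝔣_{j7}(P₂/dr)/log P₂ + O(C₁𝓛⁻¹⁵)` for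
  `dr < P₂/T`) and the ε-free Lemma 12.3 (`N = (L′Π(d,r)/log P₁)𝓦ˣ_j(dr) + O(C₁𝓛⁻¹⁵)` on `P″₁ < dr < P₂`) hold
  at this `D, χ, j`, THEN `S_j(𝐚₁₂,𝐚₂₅)|_{P″₁<dr<P₂}` differs from the gathered main term
  `Σ_{⌊P″₁⌋<n<⌈P₃⌉}Σ_{dr=n} w_j(d,r)(ῑ₃A₃+ῑ₄A₂)B + Σ_{⌈P₃⌉≤n<⌈P₂⌉}Σ_{dr=n} w_j(d,r)(ῑ₄A₂)B` by at most
  `K(log T)⁷𝓛⁻¹⁷` (`= K𝓛^{−9.3} = o(α)`). Four sub-ranges: `n < P₃/T` (all three inner sums approximated),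
  `P₃/T ≤ n < P₃` (`M₃` trivially bounded, `Section9GatheringInputs.norm_M3_le`), `P₃ ≤ n < P₂/T` (`M₃ = 0`),
  `P₂/T ≤ n < P₂` (`M₂` trivially bounded); the weights are summed by
  `Section8FrontEnd44Reduction.range_sum_le`, the monomials compared by `…scales`.

## References

* Y. Zhang, arXiv:2211.02515v1 (2022), §12 (12.13) p. 71, tex L3614; §8 p. 47, tex L2436; §9 p. 51.
  [cite: Zhang2022LandauSiegel, §12 (12.13) p. 71]
-/

noncomputable section

open Complex Real ComplexConjugate Finset

namespace Literature.NumberTheory.LFunctions.Zhang2022.Typed.Sec12C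

open Literature.NumberTheory.LFunctions.Zhang2022.Skeleton
open Literature.NumberTheory.LFunctions.Zhang2022.Section8FrontEnd82
open Literature.NumberTheory.LFunctions.Zhang2022.Section8FrontEnd44Sizes
open Literature.NumberTheory.LFunctions.Zhang2022.Section8FrontEnd44Reduction
open Literature.NumberTheory.LFunctions.Zhang2022.Typed.Sec10C.Ranges1422 (alpha_facts
  norm_deriv_L_one_le log_le_of_le_bigP three_le_of_ell)

namespace Top1225

/-! ## Two pointwise bookkeeping shapes of the top range -/

/-- Window shape: `‖MN − AB‖ ≤ (m(σ+δ) + aσ)(1+Pn)` from `‖M‖ ≤ m`, `‖N − B‖ ≤ δ`, `‖A‖ ≤ a`,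
`‖B‖ ≤ σ·Pn`. [cite: Zhang2022LandauSiegel, §8 p. 47, tex L2436] -/
theorem pw_window {M N A B : ℂ} {m δ a σ Pn : ℝ} (hM : ‖M‖ ≤ m) (hN : ‖N - B‖ ≤ δ)
    (hA : ‖A‖ ≤ a) (hB : ‖B‖ ≤ σ * Pn) (hPn : 0 ≤ Pn) (hσ : 0 ≤ σ) :
    ‖M * N - A * B‖ ≤ (m * (σ + δ) + a * σ) * (1 + Pn) := by
  have hm : 0 ≤ m := (norm_nonneg _).trans hM
  have hδ : 0 ≤ δ := (norm_nonneg _).trans hN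
  have ha : 0 ≤ a := (norm_nonneg _).trans hA
  have hNle : ‖N‖ ≤ σ * Pn + δ := by
    calc ‖N‖ = ‖B + (N - B)‖ := by ring_nf
      _ ≤ ‖B‖ + ‖N - B‖ := norm_add_le _ _
      _ ≤ σ * Pn + δ := add_le_add hB hN
  calc ‖M * N - A * B‖ ≤ ‖M * N‖ + ‖A * B‖ := norm_sub_le _ _
    _ = ‖M‖ * ‖N‖ + ‖A‖ * ‖B‖ := by rw [norm_mul, norm_mul]
    _ ≤ m * (σ * Pn + δ) + a * (σ * Pn) :=
        add_le_add (mul_le_mul hM hNle (norm_nonneg _) hm) (mul_le_mul hA hB (norm_nonneg _) ha)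
    _ ≤ (m * (σ + δ) + a * σ) * (1 + Pn) := by
        nlinarith [mul_nonneg hm hσ, mul_nonneg hm hδ, mul_nonneg ha hσ,
          mul_nonneg (mul_nonneg hm hδ) hPn, mul_nonneg (mul_nonneg ha hσ) hPn]

/-- Main shape with a two-term first factor: `‖(ι₃M₃+ι₄M₂)N − (ι₃A₃+ι₄A₂)B‖ ≤ 50δσ(1+Pn)` from
`‖M_k − A_k‖ ≤ δ`, `‖N − B‖ ≤ δ`, `‖A_k‖ ≤ σ`, `‖B‖ ≤ σPn`, `‖ι_k‖ ≤ 2.3`, `δ ≤ σ`.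
[cite: Zhang2022LandauSiegel, §8 p. 47, tex L2436] -/
theorem pw_main2 {ι₃ ι₄ M₃ M₂ N A₃ A₂ B : ℂ} {δ σ Pn : ℝ} (h3 : ‖ι₃‖ ≤ 2.3) (h4 : ‖ι₄‖ ≤ 2.3)
    (hM₃ : ‖M₃ - A₃‖ ≤ δ) (hM₂ : ‖M₂ - A₂‖ ≤ δ) (hN : ‖N - B‖ ≤ δ) (hA₃ : ‖A₃‖ ≤ σ)
    (hA₂ : ‖A₂‖ ≤ σ) (hB : ‖B‖ ≤ σ * Pn) (hPn : 0 ≤ Pn) (hδσ : δ ≤ σ) :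
    ‖(ι₃ * M₃ + ι₄ * M₂) * N - (ι₃ * A₃ + ι₄ * A₂) * B‖ ≤ 50 * δ * σ * (1 + Pn) := by
  have hδ : 0 ≤ δ := (norm_nonneg _).trans hM₃
  have hMA : ‖(ι₃ * M₃ + ι₄ * M₂) - (ι₃ * A₃ + ι₄ * A₂)‖ ≤ 5 * δ := by
    have e : (ι₃ * M₃ + ι₄ * M₂) - (ι₃ * A₃ + ι₄ * A₂) = ι₃ * (M₃ - A₃) + ι₄ * (M₂ - A₂) := by ring
    rw [e]
    refine (norm_add_le _ _).trans ?_
    rw [norm_mul, norm_mul]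
    have i1 := mul_le_mul h3 hM₃ (norm_nonneg _) (by norm_num : (0:ℝ) ≤ 2.3)
    have i2 := mul_le_mul h4 hM₂ (norm_nonneg _) (by norm_num : (0:ℝ) ≤ 2.3)
    linarith
  have hσ0 : 0 ≤ σ := hδ.trans hδσ
  have hA : ‖ι₃ * A₃ + ι₄ * A₂‖ ≤ 5 * σ := by
    refine (norm_add_le _ _).trans ?_
    rw [norm_mul, norm_mul]
    have i1 := mul_le_mul h3 hA₃ (norm_nonneg _) (by norm_num : (0:ℝ) ≤ 2.3)
    have i2 := mul_le_mul h4 hA₂ (norm_nonneg _) (by norm_num : (0:ℝ) ≤ 2.3)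
    linarith
  have hN' : ‖N - B‖ ≤ 5 * δ := hN.trans (by linarith)
  have hB' : ‖B‖ ≤ 5 * σ * Pn := hB.trans (by nlinarith [mul_nonneg hσ0 hPn])
  have h := pointwise_III hMA hN' hA hB' hPn (by linarith)
  calc ‖(ι₃ * M₃ + ι₄ * M₂) * N - (ι₃ * A₃ + ι₄ * A₂) * B‖
      ≤ 2 * (5 * δ) * (5 * σ) * (1 + Pn) := h
    _ = 50 * δ * σ * (1 + Pn) := by ring

/-! ## The core estimate for fixed `D`, `χ`, `j` -/

-- one long assembly (four ranges × pointwise inputs × weights): above the default budget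
set_option maxHeartbeats 800000 in
/-- **Core estimate of the top range of `S_j(𝐚₁₂,𝐚₂₅)`** (the §12 twin of `Section8FrontEnd44Reduction.core`).
For a constant `C₁ ≥ 0` there is `K = K(c′, C₁)` such that: for every `D` with `𝓛 ≥ 5`, real primitive `χ`
and `j`, if at this `D, χ, j` the Lemma 8.2 applications hold on `dr < P₃/T` (`ϰ₃`, `μ = 6`) and `dr < P₂/T`
(`ϰ₂`, `μ = 7`) with error `C₁𝓛⁻¹⁵`, and the ε-free Lemma 12.3 holds on `P″₁ < dr < P₂` with error `C₁𝓛⁻¹⁵`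
(main term `(L′(1,χ)Π(d,r)/log P₁)·𝓦ˣ_j(dr)`), then the top range of `S_j(𝐚₁₂,𝐚₂₅)` differs from its
gathered main term by at most `K(log T)⁷𝓛⁻¹⁷`. [cite: Zhang2022LandauSiegel, §12 (12.13) p. 71, tex L3614] -/
theorem core_top (c' : ℝ) {C₁ : ℝ} (hC₁ : 0 ≤ C₁) :
    ∃ K : ℝ, 0 ≤ K ∧ ∀ {D : ℕ} [NeZero D] {χ : DirichletCharacter ℂ D}, χ.IsQuadratic →
      χ.IsPrimitive → 5 ≤ ell D → ∀ j : ℕ, ∀ a25 : ℕ → ℂ,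
      (∀ n, a25 n = conj (χ (n : ZMod D) * vk13 D n)) →
      (∀ d r : ℕ, 1 ≤ d → 1 ≤ r → ((d * r : ℕ) : ℝ) < Skeleton.P3 D / bigT D →
        ‖(∑ m ∈ Finset.Ico 1 (Nsupp D),
              χ (m : ZMod D) * vk3 D (d * r * m) / (m : ℂ) ^ (1 - betaJ c' D j)) -
            deriv χ.LFunction 1 / (Real.log (Skeleton.P3 D) : ℂ) *
              frakfW c' D j 6 (Skeleton.P3 D / ((d * r : ℕ) : ℝ))‖ ≤ C₁ / ell D ^ 15) →
      (∀ d r : ℕ, 1 ≤ d → 1 ≤ r → ((d * r : ℕ) : ℝ) < Skeleton.P2 D / bigT D →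
        ‖(∑ m ∈ Finset.Ico 1 (Nsupp D),
              χ (m : ZMod D) * vk2 D (d * r * m) / (m : ℂ) ^ (1 - betaJ c' D j)) -
            deriv χ.LFunction 1 / (Real.log (Skeleton.P2 D) : ℂ) *
              frakfW c' D j 7 (Skeleton.P2 D / ((d * r : ℕ) : ℝ))‖ ≤ C₁ / ell D ^ 15) →
      (∀ d r : ℕ, 1 ≤ d → 1 ≤ r → P1pp D < ((d * r : ℕ) : ℝ) → ((d * r : ℕ) : ℝ) < Skeleton.P2 D →
        ‖(∑ n ∈ Finset.Ico 1 (Nsupp D),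
              χ (n : ZMod D) * conj (vk13 D (d * r * n)) * xiZero c' D j n d r / (n : ℂ)) -
            1 / (Real.log (Skeleton.P1 D) : ℂ) * (deriv χ.LFunction 1 * PiW χ d r) *
              frakwEx c' D j ((d * r : ℕ) : ℝ)‖ ≤ C₁ / ell D ^ 15) →
      ‖SjOn c' D j (a12 χ) a25 (rngTop D) -
          ((∑ n ∈ Finset.Ico (⌊P1pp D⌋₊ + 1) ⌈Skeleton.P3 D⌉₊, ∑ p ∈ Nat.divisorsAntidiagonal n,
              ((ArithmeticFunction.moebius p.2).natAbs : ℂ) * (‖χ ((p.1 * p.2 : ℕ) : ZMod D)‖ : ℂ) /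
                    (((p.1 * p.2 : ℕ) : ℂ) * (Nat.totient p.2 : ℂ)) * lamZero c' D j (p.1 * p.2) *
                ((conj iota3 * (deriv χ.LFunction 1 / (Real.log (Skeleton.P3 D) : ℂ) *
                      frakfW c' D j 6 (Skeleton.P3 D / ((p.1 * p.2 : ℕ) : ℝ))) +
                    conj iota4 * (deriv χ.LFunction 1 / (Real.log (Skeleton.P2 D) : ℂ) *
                      frakfW c' D j 7 (Skeleton.P2 D / ((p.1 * p.2 : ℕ) : ℝ)))) *
                  (1 / (Real.log (Skeleton.P1 D) : ℂ) * (deriv χ.LFunction 1 * PiW χ p.1 p.2) *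
                    frakwEx c' D j ((p.1 * p.2 : ℕ) : ℝ)))) +
            ∑ n ∈ Finset.Ico ⌈Skeleton.P3 D⌉₊ ⌈Skeleton.P2 D⌉₊, ∑ p ∈ Nat.divisorsAntidiagonal n,
              ((ArithmeticFunction.moebius p.2).natAbs : ℂ) * (‖χ ((p.1 * p.2 : ℕ) : ZMod D)‖ : ℂ) /
                    (((p.1 * p.2 : ℕ) : ℂ) * (Nat.totient p.2 : ℂ)) * lamZero c' D j (p.1 * p.2) *
                (conj iota4 * (deriv χ.LFunction 1 / (Real.log (Skeleton.P2 D) : ℂ) *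
                    frakfW c' D j 7 (Skeleton.P2 D / ((p.1 * p.2 : ℕ) : ℝ))) *
                  (1 / (Real.log (Skeleton.P1 D) : ℂ) * (deriv χ.LFunction 1 * PiW χ p.1 p.2) *
                    frakwEx c' D j ((p.1 * p.2 : ℕ) : ℝ))))‖ ≤
        K * (ell D ^ (1.1 : ℝ)) ^ 7 / ell D ^ 17 := by
  obtain ⟨F₀, hF₀⟩ : ∃ F₀ : ℝ, F₀ = 1 + (5.5 + 60 * |c'|) * π := ⟨_, rfl⟩
  obtain ⟨W₀, hW₀⟩ : ∃ W₀ : ℝ,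
      W₀ = 1 + 3 * (3 * π * (1 + 5 * |c'| * π)) + 2 * (3 * π * (1 + 5 * |c'| * π)) ^ 2 := ⟨_, rfl⟩
  have hF₀0 : 0 ≤ F₀ := by rw [hF₀]; positivity
  have hW₀0 : 0 ≤ W₀ := by rw [hW₀]; positivity
  obtain ⟨S, hS⟩ : ∃ S : ℝ, S = 16 * Real.exp (9 / 2) * (F₀ + W₀) + C₁ + 1 := ⟨_, rfl⟩
  have hS0 : 0 ≤ S := by rw [hS]; positivity
  have hC₁S : C₁ ≤ S := by
    rw [hS]; have : 0 ≤ 16 * Real.exp (9 / 2) * (F₀ + W₀) := by positivity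
    linarith
  refine ⟨2 * Real.exp 106 * (140 * C₁ * S + 200 * S + 40 * S ^ 2), by positivity, ?_⟩
  intro D _ χ hq hχ hℓ5 j a25 ha25 h92 h41 h30
  -- parameters
  have hL4 : 4 ≤ ell D := by linarith
  have hL3 : 3 ≤ ell D := by linarith
  have hL2 : 2 ≤ ell D := by linarith
  have hL1 : 1 ≤ ell D := by linarith
  have hL0 : 0 < ell D := by linarith
  have hD3 : 3 ≤ D := three_le_of_ell hL3
  obtain ⟨hlogP1, hlogP2, -, -, -, -, hP1P, hP2P⟩ := params hL2
  obtain ⟨hTP2, -, hlogT, hLτ, hT1⟩ := params2 hL2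
  obtain ⟨hlogP3, hlogP3', hP3PT, hTP3, hP3TP2, hP3P⟩ := Section9Gathering.params3 hL4
  obtain ⟨h2TP1pp, hP1pp1, hP1ppP3, hP32, hP2N, hP2P', -⟩ := top_range_sizes hℓ5
  have hL' : ‖deriv χ.LFunction 1‖ ≤ 4 * Real.exp (9 / 2) * ell D ^ 2 :=
    norm_deriv_L_one_le χ hL3 hχ
  have hι3 : ‖iota3‖ ≤ 2.3 := Section9Gathering.norm_iota3_le.trans (by norm_num)
  have hι4 : ‖iota4‖ ≤ 2.3 := Section9Gathering.norm_iota4_le_two.trans (by norm_num)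
  set τ : ℝ := ell D ^ (1.1 : ℝ) with hτdef
  have hτ1 : 1 ≤ τ := hL1.trans hLτ
  have hτ0 : 0 < τ := by linarith
  have hT0 : 0 < bigT D := by linarith
  have hP2pos : 0 < Skeleton.P2 D := by linarith
  have hP3pos : 0 < Skeleton.P3 D := by linarith
  have hP2one : 1 < Skeleton.P2 D := lt_of_lt_of_le hT1 hTP2
  have hP3one : 1 < Skeleton.P3 D := lt_of_lt_of_le hT1 hTP3
  have hP1pppos : 0 < P1pp D := by linarith
  have hP3TP3 : Skeleton.P3 D / bigT D ≤ Skeleton.P3 D := div_le_self hP3pos.le hT1.le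
  have hP2TP2 : Skeleton.P2 D / bigT D ≤ Skeleton.P2 D := div_le_self hP2pos.le hT1.le
  have hP3P2T : Skeleton.P3 D ≤ Skeleton.P2 D / bigT D := (le_div_iff₀ hT0).mpr hP3TP2
  have hP3TP2T : Skeleton.P3 D / bigT D ≤ Skeleton.P2 D / bigT D :=
    div_le_div_of_nonneg_right hP32 hT0.le
  have hlogP2' : ell D ^ 9 / 4 ≤ Real.log (Skeleton.P2 D) := by nlinarith [pow_pos hL0 9]
  have hlogP1' : ell D ^ 9 / 4 ≤ Real.log (Skeleton.P1 D) := by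
    rw [hlogP1]; nlinarith [pow_pos hL0 9]
  have hlogP1pos : 0 < Real.log (Skeleton.P1 D) := lt_of_lt_of_le (by positivity) hlogP1'
  have hlogP2pos : 0 < Real.log (Skeleton.P2 D) := lt_of_lt_of_le (by positivity) hlogP2'
  have hlogP3pos : 0 < Real.log (Skeleton.P3 D) := lt_of_lt_of_le (by positivity) hlogP3'
  have hlogP : Real.log (bigP D) = ell D ^ 9 := by rw [bigP, Real.log_exp]
  -- the lower endpoint `Y₁ = ⌊P″₁⌋ + 1`
  set Y₁ : ℕ := ⌊P1pp D⌋₊ + 1 with hY₁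
  have hY₁ge : P1pp D < (Y₁ : ℝ) := by rw [hY₁]; push_cast; exact Nat.lt_floor_add_one _
  have hY₁le : (Y₁ : ℝ) ≤ P1pp D + 1 := by
    rw [hY₁]; push_cast; linarith [Nat.floor_le hP1pppos.le]
  have hY₁1 : (1 : ℝ) ≤ Y₁ := by
    rw [hY₁]; push_cast
    have : (0 : ℝ) ≤ (⌊P1pp D⌋₊ : ℝ) := Nat.cast_nonneg _
    linarith
  have hY₁P3T : (Y₁ : ℝ) ≤ Skeleton.P3 D / bigT D := by
    rw [le_div_iff₀ hT0]
    have : (Y₁ : ℝ) * bigT D ≤ (P1pp D + 1) * bigT D := mul_le_mul_of_nonneg_right hY₁le hT0.le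
    nlinarith
  have hceilY : ⌈(Y₁ : ℝ)⌉₊ = Y₁ := Nat.ceil_natCast _
  -- scales
  have hsc := scales (L := ell D) (τ := τ) (S := S) (C₂ := 0) hL1 hLτ hS0 hC₁ le_rfl
  set δ : ℝ := C₁ / ell D ^ 15 with hδ
  set σ : ℝ := S / ell D ^ 7 with hσ
  set m : ℝ := 8 * τ ^ 2 / ell D ^ 9 with hm
  rw [mul_div_assoc]
  set u : ℝ := τ ^ 7 / ell D ^ 17 with hu
  obtain ⟨s1, s2, -, s4, -⟩ := hsc
  have hδ0 : 0 ≤ δ := by rw [hδ]; positivity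
  have hσ0 : 0 ≤ σ := by rw [hσ]; positivity
  have hm0 : 0 ≤ m := by rw [hm]; positivity
  have hu0 : 0 ≤ u := by rw [hu]; positivity
  have hδσ : δ ≤ σ := by
    rw [hδ, hσ]
    exact div_le_div₀ hS0 hC₁S (by positivity) (pow_le_pow_right₀ hL1 (by norm_num))
  have hδσ0 : 0 ≤ δ * σ := mul_nonneg hδ0 hσ0
  have hmσ0 : 0 ≤ m * σ := mul_nonneg hm0 hσ0
  have hσσ0 : 0 ≤ σ ^ 2 := sq_nonneg σ
  have he106 : 0 ≤ 2 * Real.exp 106 := by positivity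
  have hσF : 4 * Real.exp (9 / 2) * ell D ^ 2 * F₀ / (ell D ^ 9 / 4) ≤ σ := by
    rw [hσ, div_le_div_iff₀ (by positivity) (by positivity)]
    have hrest : 0 ≤ (16 * Real.exp (9 / 2) * W₀ + C₁ + 1) * ell D ^ 9 := by positivity
    calc 4 * Real.exp (9 / 2) * ell D ^ 2 * F₀ * ell D ^ 7
        = (16 * Real.exp (9 / 2) * F₀) * ell D ^ 9 / 4 := by ring
      _ ≤ ((16 * Real.exp (9 / 2) * F₀) * ell D ^ 9 +
            (16 * Real.exp (9 / 2) * W₀ + C₁ + 1) * ell D ^ 9) / 4 := by linarith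
      _ = S * (ell D ^ 9 / 4) := by rw [hS]; ring
  have hσW : 4 * Real.exp (9 / 2) * ell D ^ 2 * W₀ / (ell D ^ 9 / 4) ≤ σ := by
    rw [hσ, div_le_div_iff₀ (by positivity) (by positivity)]
    have hrest : 0 ≤ (16 * Real.exp (9 / 2) * F₀ + C₁ + 1) * ell D ^ 9 := by positivity
    calc 4 * Real.exp (9 / 2) * ell D ^ 2 * W₀ * ell D ^ 7
        = (16 * Real.exp (9 / 2) * W₀) * ell D ^ 9 / 4 := by ring
      _ ≤ ((16 * Real.exp (9 / 2) * W₀) * ell D ^ 9 +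
            (16 * Real.exp (9 / 2) * F₀ + C₁ + 1) * ell D ^ 9) / 4 := by linarith
      _ = S * (ell D ^ 9 / 4) := by rw [hS]; ring
  -- the main-term sizes, abstractly
  have hAk : ∀ {Q y : ℝ} (μ : ℕ), ell D ^ 9 / 4 ≤ Real.log Q → 1 ≤ y → y ≤ bigP D →
      ‖deriv χ.LFunction 1 / (Real.log Q : ℂ) * frakfW c' D j μ y‖ ≤ σ := by
    intro Q y μ hℓQ hy1 hyP
    have hlogQ : 0 < Real.log Q := lt_of_lt_of_le (by positivity) hℓQ
    have hf : ‖frakfW c' D j μ y‖ ≤ F₀ := by rw [hF₀]; exact norm_frakfW_le c' hD3 j μ hy1 hyP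
    rw [norm_mul, norm_div, Complex.norm_real, Real.norm_of_nonneg hlogQ.le]
    calc ‖deriv χ.LFunction 1‖ / Real.log Q * ‖frakfW c' D j μ y‖
        ≤ 4 * Real.exp (9 / 2) * ell D ^ 2 / (ell D ^ 9 / 4) * F₀ :=
          mul_le_mul (div_le_div₀ (by positivity) hL' (by positivity) hℓQ) hf (norm_nonneg _)
            (by positivity)
      _ = 4 * Real.exp (9 / 2) * ell D ^ 2 * F₀ / (ell D ^ 9 / 4) := by ring
      _ ≤ σ := hσF
  have hBk : ∀ {y : ℝ} (d r : ℕ), 1 ≤ y → y ≤ bigP D →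
      ‖1 / (Real.log (Skeleton.P1 D) : ℂ) * (deriv χ.LFunction 1 * PiW χ d r) * frakwEx c' D j y‖ ≤
        σ * ‖PiW χ d r‖ := by
    intro y d r hy1 hyP
    have hw : ‖frakwEx c' D j y‖ ≤ W₀ := by rw [hW₀]; exact norm_frakwEx_le c' hL3 j hy1 hyP
    rw [norm_mul, norm_mul, norm_mul, norm_div, norm_one, Complex.norm_real,
      Real.norm_of_nonneg hlogP1pos.le]
    calc 1 / Real.log (Skeleton.P1 D) * (‖deriv χ.LFunction 1‖ * ‖PiW χ d r‖) * ‖frakwEx c' D j y‖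
        = ‖deriv χ.LFunction 1‖ / Real.log (Skeleton.P1 D) * ‖frakwEx c' D j y‖ * ‖PiW χ d r‖ := by
          ring
      _ ≤ 4 * Real.exp (9 / 2) * ell D ^ 2 / (ell D ^ 9 / 4) * W₀ * ‖PiW χ d r‖ :=
          mul_le_mul_of_nonneg_right
            (mul_le_mul (div_le_div₀ (by positivity) hL' (by positivity) hlogP1') hw (norm_nonneg _)
              (by positivity)) (norm_nonneg _)
      _ = 4 * Real.exp (9 / 2) * ell D ^ 2 * W₀ / (ell D ^ 9 / 4) * ‖PiW χ d r‖ := by ring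
      _ ≤ σ * ‖PiW χ d r‖ := mul_le_mul_of_nonneg_right hσW (norm_nonneg _)
  -- the objects
  set M₃ : ℕ × ℕ → ℂ := fun p => ∑ m ∈ Finset.Ico 1 (Nsupp D),
    χ (m : ZMod D) * vk3 D (p.1 * p.2 * m) / (m : ℂ) ^ (1 - betaJ c' D j) with hM₃
  set M₂ : ℕ × ℕ → ℂ := fun p => ∑ m ∈ Finset.Ico 1 (Nsupp D),
    χ (m : ZMod D) * vk2 D (p.1 * p.2 * m) / (m : ℂ) ^ (1 - betaJ c' D j) with hM₂
  set N : ℕ × ℕ → ℂ := fun p => ∑ n ∈ Finset.Ico 1 (Nsupp D),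
    χ (n : ZMod D) * conj (vk13 D (p.1 * p.2 * n)) * xiZero c' D j n p.1 p.2 / (n : ℂ) with hN
  set A₃ : ℕ × ℕ → ℂ := fun p => deriv χ.LFunction 1 / (Real.log (Skeleton.P3 D) : ℂ) *
    frakfW c' D j 6 (Skeleton.P3 D / ((p.1 * p.2 : ℕ) : ℝ)) with hA₃
  set A₂ : ℕ × ℕ → ℂ := fun p => deriv χ.LFunction 1 / (Real.log (Skeleton.P2 D) : ℂ) *
    frakfW c' D j 7 (Skeleton.P2 D / ((p.1 * p.2 : ℕ) : ℝ)) with hA₂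
  set B : ℕ × ℕ → ℂ := fun p => 1 / (Real.log (Skeleton.P1 D) : ℂ) *
    (deriv χ.LFunction 1 * PiW χ p.1 p.2) * frakwEx c' D j ((p.1 * p.2 : ℕ) : ℝ) with hB
  set w : ℕ × ℕ → ℂ := fun p => ((ArithmeticFunction.moebius p.2).natAbs : ℂ) *
    (‖χ ((p.1 * p.2 : ℕ) : ZMod D)‖ : ℂ) / (((p.1 * p.2 : ℕ) : ℂ) * (Nat.totient p.2 : ℂ)) *
    lamZero c' D j (p.1 * p.2) with hw
  -- Step 1: the exact form of the top range, split at `⌈P₃⌉`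
  have hY₁P3 : Y₁ ≤ ⌈Skeleton.P3 D⌉₊ := by
    have : (Y₁ : ℝ) ≤ Skeleton.P3 D := hY₁P3T.trans hP3TP3
    exact_mod_cast this.trans (Nat.le_ceil _)
  have hP3P2c : ⌈Skeleton.P3 D⌉₊ ≤ ⌈Skeleton.P2 D⌉₊ := Nat.ceil_mono hP32
  have hSj : SjOn c' D j (a12 χ) a25 (rngTop D) =
      (∑ n ∈ Finset.Ico Y₁ ⌈Skeleton.P3 D⌉₊, ∑ p ∈ Nat.divisorsAntidiagonal n,
          w p * ((conj iota3 * M₃ p + conj iota4 * M₂ p) * N p)) +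
        ∑ n ∈ Finset.Ico ⌈Skeleton.P3 D⌉₊ ⌈Skeleton.P2 D⌉₊, ∑ p ∈ Nat.divisorsAntidiagonal n,
          w p * ((conj iota3 * M₃ p + conj iota4 * M₂ p) * N p) := by
    rw [SjOn_top_eq c' χ hq hP2N j ha25, ← hY₁, Finset.sum_Ico_consecutive _ hY₁P3 hP3P2c]
  -- Step 2: pointwise facts on the factorisations `n = dr`
  have hfacts : ∀ {n : ℕ} {p : ℕ × ℕ}, p ∈ Nat.divisorsAntidiagonal n →
      p.1 * p.2 = n ∧ 1 ≤ p.1 ∧ 1 ≤ p.2 ∧ 1 ≤ n := by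
    intro n p hp
    obtain ⟨hpn, hn0⟩ := Nat.mem_divisorsAntidiagonal.mp hp
    refine ⟨hpn, Nat.one_le_iff_ne_zero.mpr fun h => hn0 (by rw [← hpn, h, zero_mul]),
      Nat.one_le_iff_ne_zero.mpr fun h => hn0 (by rw [← hpn, h, mul_zero]),
      Nat.one_le_iff_ne_zero.mpr hn0⟩
  have hA₃p : ∀ {n : ℕ} {p : ℕ × ℕ}, p ∈ Nat.divisorsAntidiagonal n →
      (n : ℝ) < Skeleton.P3 D → ‖A₃ p‖ ≤ σ := by
    intro n p hp hn
    obtain ⟨hpn, -, -, hn1⟩ := hfacts hp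
    have hn1R : (1 : ℝ) ≤ n := by exact_mod_cast hn1
    simp only [hA₃]
    rw [hpn]
    exact hAk 6 hlogP3' ((one_le_div (by linarith)).mpr hn.le)
      ((div_le_self hP3pos.le hn1R).trans hP3P.le)
  have hA₂p : ∀ {n : ℕ} {p : ℕ × ℕ}, p ∈ Nat.divisorsAntidiagonal n →
      (n : ℝ) < Skeleton.P2 D → ‖A₂ p‖ ≤ σ := by
    intro n p hp hn
    obtain ⟨hpn, -, -, hn1⟩ := hfacts hp
    have hn1R : (1 : ℝ) ≤ n := by exact_mod_cast hn1
    simp only [hA₂]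
    rw [hpn]
    exact hAk 7 hlogP2' ((one_le_div (by linarith)).mpr hn.le)
      ((div_le_self hP2pos.le hn1R).trans hP2P.le)
  have hBp : ∀ {n : ℕ} {p : ℕ × ℕ}, p ∈ Nat.divisorsAntidiagonal n →
      (n : ℝ) < Skeleton.P2 D → ‖B p‖ ≤ σ * ‖PiW χ p.1 p.2‖ := by
    intro n p hp hn
    obtain ⟨hpn, -, -, hn1⟩ := hfacts hp
    have hn1R : (1 : ℝ) ≤ n := by exact_mod_cast hn1
    simp only [hB]
    rw [hpn]
    exact hBk p.1 p.2 hn1R (hn.le.trans hP2P.le)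
  have hMA₃ : ∀ {n : ℕ} {p : ℕ × ℕ}, p ∈ Nat.divisorsAntidiagonal n →
      (n : ℝ) < Skeleton.P3 D / bigT D → ‖M₃ p - A₃ p‖ ≤ δ := by
    intro n p hp hn
    obtain ⟨hpn, hp1, hp2, -⟩ := hfacts hp
    have hlt : ((p.1 * p.2 : ℕ) : ℝ) < Skeleton.P3 D / bigT D := by rw [hpn]; exact hn
    simp only [hM₃, hA₃]
    exact h92 p.1 p.2 hp1 hp2 hlt
  have hMA₂ : ∀ {n : ℕ} {p : ℕ × ℕ}, p ∈ Nat.divisorsAntidiagonal n →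
      (n : ℝ) < Skeleton.P2 D / bigT D → ‖M₂ p - A₂ p‖ ≤ δ := by
    intro n p hp hn
    obtain ⟨hpn, hp1, hp2, -⟩ := hfacts hp
    have hlt : ((p.1 * p.2 : ℕ) : ℝ) < Skeleton.P2 D / bigT D := by rw [hpn]; exact hn
    simp only [hM₂, hA₂]
    exact h41 p.1 p.2 hp1 hp2 hlt
  have hNB : ∀ {n : ℕ} {p : ℕ × ℕ}, p ∈ Nat.divisorsAntidiagonal n → Y₁ ≤ n →
      (n : ℝ) < Skeleton.P2 D → ‖N p - B p‖ ≤ δ := by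
    intro n p hp hnY hn
    obtain ⟨hpn, hp1, hp2, -⟩ := hfacts hp
    have hlo : P1pp D < ((p.1 * p.2 : ℕ) : ℝ) := by
      rw [hpn]; exact lt_of_lt_of_le hY₁ge (by exact_mod_cast hnY)
    have hhi : ((p.1 * p.2 : ℕ) : ℝ) < Skeleton.P2 D := by rw [hpn]; exact hn
    simp only [hN, hB]
    exact h30 p.1 p.2 hp1 hp2 hlo hhi
  have hM₃0 : ∀ {n : ℕ} {p : ℕ × ℕ}, p ∈ Nat.divisorsAntidiagonal n →
      Skeleton.P3 D ≤ n → M₃ p = 0 := by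
    intro n p hp hn
    obtain ⟨hpn, -, -, -⟩ := hfacts hp
    simp only [hM₃]
    refine Finset.sum_eq_zero fun m hm => ?_
    rw [Finset.mem_Ico] at hm
    rw [Section9FrontEndExact.vk3_eq_zero_of_le (by rw [hpn]; exact hn) hm.1, mul_zero, zero_div]
  -- the tail ranges: `x = P_k/n ∈ [1, T]`
  have htail : ∀ {Q : ℝ} {n : ℕ}, 0 < Q → Q / bigT D ≤ n → (n : ℝ) < Q →
      1 ≤ Q / n ∧ Q / n ≤ bigT D ∧ 0 ≤ Real.log (Q / n) ∧ Real.log (Q / n) ≤ τ := by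
    intro Q n hQ hTn hn
    have hnR : (0 : ℝ) < n := lt_of_lt_of_le (div_pos hQ hT0) hTn
    have hx1 : 1 ≤ Q / n := (one_le_div hnR).mpr hn.le
    have hxT : Q / n ≤ bigT D := by
      rw [div_le_iff₀ hnR]
      have := (div_le_iff₀ hT0).mp hTn
      linarith [mul_comm (n : ℝ) (bigT D)]
    refine ⟨hx1, hxT, Real.log_nonneg hx1, ?_⟩
    rw [← hlogT]
    exact Real.log_le_log (div_pos hQ hnR) hxT
  have hMm : ∀ {Q x : ℝ}, ell D ^ 9 / 4 ≤ Real.log Q → 0 ≤ Real.log x → Real.log x ≤ τ →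
      Real.log x / Real.log Q * (1 + Real.log x) ≤ m := by
    intro Q x hℓQ h0 hτ'
    calc Real.log x / Real.log Q * (1 + Real.log x)
        ≤ τ / (ell D ^ 9 / 4) * (2 * τ) :=
          mul_le_mul (div_le_div₀ hτ0.le hτ' (by positivity) hℓQ) (by linarith) (by linarith)
            (div_nonneg hτ0.le (by positivity))
      _ = 8 * τ ^ 2 / ell D ^ 9 := by ring
      _ = m := hm.symm
  have hM₃m : ∀ {n : ℕ} {p : ℕ × ℕ}, p ∈ Nat.divisorsAntidiagonal n →
      Skeleton.P3 D / bigT D ≤ n → (n : ℝ) < Skeleton.P3 D → ‖M₃ p‖ ≤ m := by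
    intro n p hp hTn hn
    obtain ⟨hpn, -, -, hn1⟩ := hfacts hp
    obtain ⟨-, -, h0, hτ'⟩ := htail hP3pos hTn hn
    have h := Section9Gathering.norm_M3_le c' χ hL4 j (k := p.1 * p.2) (by rw [hpn]; exact hn1)
      (by rw [hpn]; exact hn)
    have hcast : ((p.1 * p.2 : ℕ) : ℝ) = (n : ℝ) := by rw [hpn]
    rw [hcast] at h
    simp only [hM₃]
    exact h.trans (hMm hlogP3' h0 hτ')
  have hM₂m : ∀ {n : ℕ} {p : ℕ × ℕ}, p ∈ Nat.divisorsAntidiagonal n →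
      Skeleton.P2 D / bigT D ≤ n → (n : ℝ) < Skeleton.P2 D → ‖M₂ p‖ ≤ m := by
    intro n p hp hTn hn
    obtain ⟨hpn, -, -, hn1⟩ := hfacts hp
    obtain ⟨-, -, h0, hτ'⟩ := htail hP2pos hTn hn
    have h := norm_M2_le c' χ hL2 j (k := p.1 * p.2) (by rw [hpn]; exact hn1) (by rw [hpn]; exact hn)
    have hcast : ((p.1 * p.2 : ℕ) : ℝ) = (n : ℝ) := by rw [hpn]
    rw [hcast] at h
    simp only [hM₂]
    exact h.trans (hMm hlogP2' h0 hτ')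
  -- Step 3: the four range totals
  have hmem : ∀ {Y Z : ℝ} {n : ℕ}, n ∈ Finset.Ico ⌈Y⌉₊ ⌈Z⌉₊ → Y ≤ n ∧ (n : ℝ) < Z :=
    fun h => ⟨Nat.ceil_le.mp (Finset.mem_Ico.mp h).1, Nat.lt_ceil.mp (Finset.mem_Ico.mp h).2⟩
  have hEI0 : 0 ≤ 50 * δ * σ := by positivity
  have hEII0 : 0 ≤ (2.3 * m + 5 * σ) * (σ + δ) + 5 * σ * σ := by positivity
  have hEIII0 : 0 ≤ 2.3 * (2 * δ * σ) := by positivity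
  have hEIV0 : 0 ≤ 2.3 * m * (σ + δ) + 2.3 * σ * σ := by positivity
  have TI : ∑ n ∈ Finset.Ico ⌈(Y₁ : ℝ)⌉₊ ⌈Skeleton.P3 D / bigT D⌉₊, ∑ p ∈ Nat.divisorsAntidiagonal n,
      ‖w p‖ * ‖(conj iota3 * M₃ p + conj iota4 * M₂ p) * N p -
        (conj iota3 * A₃ p + conj iota4 * A₂ p) * B p‖ ≤
      2 * Real.exp 106 * (50 * δ * σ) * (1 + Real.log (Skeleton.P3 D / bigT D / Y₁)) := by
    have h := range_sum_le c' χ j (Y := (Y₁ : ℝ)) (Z := Skeleton.P3 D / bigT D) (E := 50 * δ * σ)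
      hY₁1 hY₁P3T hEI0
      (fun p => (conj iota3 * M₃ p + conj iota4 * M₂ p) * N p -
        (conj iota3 * A₃ p + conj iota4 * A₂ p) * B p)
      (fun n hn p hp => by
        have hnlt : (n : ℝ) < Skeleton.P3 D / bigT D := (hmem hn).2
        have hnY : Y₁ ≤ n := by have := (hmem hn).1; exact_mod_cast this
        have h2T : (n : ℝ) < Skeleton.P2 D / bigT D := lt_of_lt_of_le hnlt hP3TP2T
        have h3 : (n : ℝ) < Skeleton.P3 D := lt_of_lt_of_le hnlt hP3TP3
        have h2 : (n : ℝ) < Skeleton.P2 D := lt_of_lt_of_le h3 hP32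
        exact pw_main2 (by rw [Complex.norm_conj]; exact hι3) (by rw [Complex.norm_conj]; exact hι4)
          (hMA₃ hp hnlt) (hMA₂ hp h2T) (hNB hp hnY h2) (hA₃p hp h3) (hA₂p hp h2) (hBp hp h2)
          (norm_nonneg _) hδσ)
    simpa only [hw] using h
  have TII : ∑ n ∈ Finset.Ico ⌈Skeleton.P3 D / bigT D⌉₊ ⌈Skeleton.P3 D⌉₊,
      ∑ p ∈ Nat.divisorsAntidiagonal n,
      ‖w p‖ * ‖(conj iota3 * M₃ p + conj iota4 * M₂ p) * N p -
        (conj iota3 * A₃ p + conj iota4 * A₂ p) * B p‖ ≤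
      2 * Real.exp 106 * ((2.3 * m + 5 * σ) * (σ + δ) + 5 * σ * σ) *
        (1 + Real.log (Skeleton.P3 D / (Skeleton.P3 D / bigT D))) := by
    have h := range_sum_le c' χ j (Y := Skeleton.P3 D / bigT D) (Z := Skeleton.P3 D)
      (E := (2.3 * m + 5 * σ) * (σ + δ) + 5 * σ * σ) (hY₁1.trans hY₁P3T) hP3TP3 hEII0
      (fun p => (conj iota3 * M₃ p + conj iota4 * M₂ p) * N p -
        (conj iota3 * A₃ p + conj iota4 * A₂ p) * B p)
      (fun n hn p hp => by
        obtain ⟨hnT, hn3⟩ := hmem hn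
        have hnY : Y₁ ≤ n := by
          have : (Y₁ : ℝ) ≤ n := hY₁P3T.trans hnT
          exact_mod_cast this
        have h2T : (n : ℝ) < Skeleton.P2 D / bigT D := lt_of_lt_of_le hn3 hP3P2T
        have h2 : (n : ℝ) < Skeleton.P2 D := lt_of_lt_of_le hn3 hP32
        have hMle : ‖conj iota3 * M₃ p + conj iota4 * M₂ p‖ ≤ 2.3 * m + 5 * σ := by
          have hM₂le : ‖M₂ p‖ ≤ σ + δ := by
            calc ‖M₂ p‖ = ‖A₂ p + (M₂ p - A₂ p)‖ := by ring_nf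
              _ ≤ ‖A₂ p‖ + ‖M₂ p - A₂ p‖ := norm_add_le _ _
              _ ≤ σ + δ := add_le_add (hA₂p hp h2) (hMA₂ hp h2T)
          refine (norm_add_le _ _).trans ?_
          rw [norm_mul (conj iota3) (M₃ p), norm_mul (conj iota4) (M₂ p), Complex.norm_conj,
            Complex.norm_conj]
          have i1 := mul_le_mul hι3 (hM₃m hp hnT hn3) (norm_nonneg _) (by norm_num : (0:ℝ) ≤ 2.3)
          have i2 := mul_le_mul hι4 hM₂le (norm_nonneg _) (by norm_num : (0:ℝ) ≤ 2.3)
          linarith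
        have hAle : ‖conj iota3 * A₃ p + conj iota4 * A₂ p‖ ≤ 5 * σ := by
          refine (norm_add_le _ _).trans ?_
          rw [norm_mul (conj iota3) (A₃ p), norm_mul (conj iota4) (A₂ p), Complex.norm_conj,
            Complex.norm_conj]
          have i1 := mul_le_mul hι3 (hA₃p hp hn3) (norm_nonneg _) (by norm_num : (0:ℝ) ≤ 2.3)
          have i2 := mul_le_mul hι4 (hA₂p hp h2) (norm_nonneg _) (by norm_num : (0:ℝ) ≤ 2.3)
          linarith
        exact pw_window hMle (hNB hp hnY h2) hAle (hBp hp h2) (norm_nonneg _) hσ0)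
    simpa only [hw] using h
  have TIII : ∑ n ∈ Finset.Ico ⌈Skeleton.P3 D⌉₊ ⌈Skeleton.P2 D / bigT D⌉₊,
      ∑ p ∈ Nat.divisorsAntidiagonal n,
      ‖w p‖ * ‖(conj iota3 * M₃ p + conj iota4 * M₂ p) * N p - conj iota4 * A₂ p * B p‖ ≤
      2 * Real.exp 106 * (2.3 * (2 * δ * σ)) *
        (1 + Real.log (Skeleton.P2 D / bigT D / Skeleton.P3 D)) := by
    have h := range_sum_le c' χ j (Y := Skeleton.P3 D) (Z := Skeleton.P2 D / bigT D)
      (E := 2.3 * (2 * δ * σ)) hP3one.le hP3P2T hEIII0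
      (fun p => (conj iota3 * M₃ p + conj iota4 * M₂ p) * N p - conj iota4 * A₂ p * B p)
      (fun n hn p hp => by
        obtain ⟨hn3, hn2T⟩ := hmem hn
        have hnY : Y₁ ≤ n := by
          have : (Y₁ : ℝ) ≤ n := (hY₁P3T.trans hP3TP3).trans hn3
          exact_mod_cast this
        have h2 : (n : ℝ) < Skeleton.P2 D := lt_of_lt_of_le hn2T hP2TP2
        rw [hM₃0 hp hn3, mul_zero, zero_add]
        have e : conj iota4 * M₂ p * N p - conj iota4 * A₂ p * B p =
            conj iota4 * (M₂ p * N p - A₂ p * B p) := by ring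
        rw [e, norm_mul (conj iota4), Complex.norm_conj]
        have h3 := pointwise_III (hMA₂ hp hn2T) (hNB hp hnY h2) (hA₂p hp h2) (hBp hp h2)
          (norm_nonneg _) hδσ
        calc ‖iota4‖ * ‖M₂ p * N p - A₂ p * B p‖ ≤ 2.3 * (2 * δ * σ * (1 + ‖PiW χ p.1 p.2‖)) :=
              mul_le_mul hι4 h3 (norm_nonneg _) (by norm_num)
          _ = 2.3 * (2 * δ * σ) * (1 + ‖PiW χ p.1 p.2‖) := by ring)
    simpa only [hw] using h
  have TIV : ∑ n ∈ Finset.Ico ⌈Skeleton.P2 D / bigT D⌉₊ ⌈Skeleton.P2 D⌉₊,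
      ∑ p ∈ Nat.divisorsAntidiagonal n,
      ‖w p‖ * ‖(conj iota3 * M₃ p + conj iota4 * M₂ p) * N p - conj iota4 * A₂ p * B p‖ ≤
      2 * Real.exp 106 * (2.3 * m * (σ + δ) + 2.3 * σ * σ) *
        (1 + Real.log (Skeleton.P2 D / (Skeleton.P2 D / bigT D))) := by
    have h := range_sum_le c' χ j (Y := Skeleton.P2 D / bigT D) (Z := Skeleton.P2 D)
      (E := 2.3 * m * (σ + δ) + 2.3 * σ * σ) (hP3one.le.trans hP3P2T) hP2TP2 hEIV0
      (fun p => (conj iota3 * M₃ p + conj iota4 * M₂ p) * N p - conj iota4 * A₂ p * B p)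
      (fun n hn p hp => by
        obtain ⟨hnT, hn2⟩ := hmem hn
        have hn3 : Skeleton.P3 D ≤ n := hP3P2T.trans hnT
        have hnY : Y₁ ≤ n := by
          have : (Y₁ : ℝ) ≤ n := (hY₁P3T.trans hP3TP3).trans hn3
          exact_mod_cast this
        rw [hM₃0 hp hn3, mul_zero, zero_add]
        have hMle : ‖conj iota4 * M₂ p‖ ≤ 2.3 * m := by
          rw [norm_mul (conj iota4) (M₂ p), Complex.norm_conj]
          exact mul_le_mul hι4 (hM₂m hp hnT hn2) (norm_nonneg _) (by norm_num)
        have hAle : ‖conj iota4 * A₂ p‖ ≤ 2.3 * σ := by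
          rw [norm_mul (conj iota4) (A₂ p), Complex.norm_conj]
          exact mul_le_mul hι4 (hA₂p hp hn2) (norm_nonneg _) (by norm_num)
        have h4 := pw_window hMle (hNB hp hnY hn2) hAle (hBp hp hn2) (norm_nonneg _) hσ0
        calc ‖conj iota4 * M₂ p * N p - conj iota4 * A₂ p * B p‖
            ≤ (2.3 * m * (σ + δ) + 2.3 * σ * σ) * (1 + ‖PiW χ p.1 p.2‖) := h4)
    simpa only [hw] using h
  -- Step 4: assemble
  have normbound : ∀ (s : Finset ℕ) (F G : ℕ × ℕ → ℂ),
      ‖(∑ n ∈ s, ∑ p ∈ Nat.divisorsAntidiagonal n, w p * F p) -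
          ∑ n ∈ s, ∑ p ∈ Nat.divisorsAntidiagonal n, w p * G p‖ ≤
        ∑ n ∈ s, ∑ p ∈ Nat.divisorsAntidiagonal n, ‖w p‖ * ‖F p - G p‖ := by
    intro s F G
    rw [← Finset.sum_sub_distrib]
    refine (norm_sum_le _ _).trans (Finset.sum_le_sum fun n _ => ?_)
    rw [← Finset.sum_sub_distrib]
    refine (norm_sum_le _ _).trans (Finset.sum_le_sum fun p _ => ?_)
    rw [← mul_sub, norm_mul]
  have h12 := normbound (Finset.Ico Y₁ ⌈Skeleton.P3 D⌉₊)
    (fun p => (conj iota3 * M₃ p + conj iota4 * M₂ p) * N p)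
    (fun p => (conj iota3 * A₃ p + conj iota4 * A₂ p) * B p)
  have h34 := normbound (Finset.Ico ⌈Skeleton.P3 D⌉₊ ⌈Skeleton.P2 D⌉₊)
    (fun p => (conj iota3 * M₃ p + conj iota4 * M₂ p) * N p) (fun p => conj iota4 * A₂ p * B p)
  beta_reduce at h12 h34
  have hc1 : Y₁ ≤ ⌈Skeleton.P3 D / bigT D⌉₊ := by exact_mod_cast hY₁P3T.trans (Nat.le_ceil _)
  have hc2 : ⌈Skeleton.P3 D / bigT D⌉₊ ≤ ⌈Skeleton.P3 D⌉₊ := Nat.ceil_mono hP3TP3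
  have hc3 : ⌈Skeleton.P3 D⌉₊ ≤ ⌈Skeleton.P2 D / bigT D⌉₊ := Nat.ceil_mono hP3P2T
  have hc4 : ⌈Skeleton.P2 D / bigT D⌉₊ ≤ ⌈Skeleton.P2 D⌉₊ := Nat.ceil_mono hP2TP2
  -- the logarithms of the range lengths
  have hlogA : Real.log (Skeleton.P3 D / bigT D / Y₁) ≤ ell D ^ 9 := by
    rw [← hlogP]
    refine Real.log_le_log (by positivity) (le_trans ?_ hP3P.le)
    exact (div_le_self (by positivity) hY₁1).trans hP3TP3
  have hlogB : Real.log (Skeleton.P3 D / (Skeleton.P3 D / bigT D)) = τ := by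
    rw [← hlogT]; congr 1; field_simp
  have hlogC : Real.log (Skeleton.P2 D / bigT D / Skeleton.P3 D) ≤ ell D ^ 9 := by
    rw [← hlogP]
    refine Real.log_le_log (by positivity) (le_trans ?_ hP2P.le)
    rw [div_div]
    exact div_le_self hP2pos.le (one_le_mul_of_one_le_of_one_le hT1.le hP3one.le)
  have hlogD : Real.log (Skeleton.P2 D / (Skeleton.P2 D / bigT D)) = τ := by
    rw [← hlogT]; congr 1; field_simp
  have hL9 : 1 ≤ ell D ^ 9 := one_le_pow₀ hL1
  -- rewrite the target's main term in the `w·(…)` form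
  have hTgt1 : (∑ n ∈ Finset.Ico Y₁ ⌈Skeleton.P3 D⌉₊, ∑ p ∈ Nat.divisorsAntidiagonal n,
        ((ArithmeticFunction.moebius p.2).natAbs : ℂ) * (‖χ ((p.1 * p.2 : ℕ) : ZMod D)‖ : ℂ) /
              (((p.1 * p.2 : ℕ) : ℂ) * (Nat.totient p.2 : ℂ)) * lamZero c' D j (p.1 * p.2) *
          ((conj iota3 * (deriv χ.LFunction 1 / (Real.log (Skeleton.P3 D) : ℂ) *
                frakfW c' D j 6 (Skeleton.P3 D / ((p.1 * p.2 : ℕ) : ℝ))) +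
              conj iota4 * (deriv χ.LFunction 1 / (Real.log (Skeleton.P2 D) : ℂ) *
                frakfW c' D j 7 (Skeleton.P2 D / ((p.1 * p.2 : ℕ) : ℝ)))) *
            (1 / (Real.log (Skeleton.P1 D) : ℂ) * (deriv χ.LFunction 1 * PiW χ p.1 p.2) *
              frakwEx c' D j ((p.1 * p.2 : ℕ) : ℝ)))) =
      ∑ n ∈ Finset.Ico Y₁ ⌈Skeleton.P3 D⌉₊, ∑ p ∈ Nat.divisorsAntidiagonal n,
        w p * ((conj iota3 * A₃ p + conj iota4 * A₂ p) * B p) := by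
    rfl
  have hTgt2 : (∑ n ∈ Finset.Ico ⌈Skeleton.P3 D⌉₊ ⌈Skeleton.P2 D⌉₊, ∑ p ∈ Nat.divisorsAntidiagonal n,
        ((ArithmeticFunction.moebius p.2).natAbs : ℂ) * (‖χ ((p.1 * p.2 : ℕ) : ZMod D)‖ : ℂ) /
              (((p.1 * p.2 : ℕ) : ℂ) * (Nat.totient p.2 : ℂ)) * lamZero c' D j (p.1 * p.2) *
          (conj iota4 * (deriv χ.LFunction 1 / (Real.log (Skeleton.P2 D) : ℂ) *
              frakfW c' D j 7 (Skeleton.P2 D / ((p.1 * p.2 : ℕ) : ℝ))) *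
            (1 / (Real.log (Skeleton.P1 D) : ℂ) * (deriv χ.LFunction 1 * PiW χ p.1 p.2) *
              frakwEx c' D j ((p.1 * p.2 : ℕ) : ℝ)))) =
      ∑ n ∈ Finset.Ico ⌈Skeleton.P3 D⌉₊ ⌈Skeleton.P2 D⌉₊, ∑ p ∈ Nat.divisorsAntidiagonal n,
        w p * (conj iota4 * A₂ p * B p) := by
    rfl
  rw [hSj, hTgt1, hTgt2, add_sub_add_comm]
  refine (norm_add_le _ _).trans ((add_le_add h12 h34).trans ?_)
  rw [← hceilY] at hc1 ⊢
  rw [← Finset.sum_Ico_consecutive _ hc1 hc2, ← Finset.sum_Ico_consecutive _ hc3 hc4]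
  refine (add_le_add (add_le_add TI TII) (add_le_add TIII TIV)).trans ?_
  rw [hlogB, hlogD]
  -- monomial bookkeeping
  have hJ : 50 * δ * σ * (2 * ell D ^ 9) +
      ((2.3 * m + 5 * σ) * (σ + δ) + 5 * σ * σ) * (2 * τ) +
      2.3 * (2 * δ * σ) * (2 * ell D ^ 9) + (2.3 * m * (σ + δ) + 2.3 * σ * σ) * (2 * τ) ≤
      (140 * C₁ * S + 200 * S + 40 * S ^ 2) * u := by
    -- the five monomials
    have ha : δ * σ * (2 * ell D ^ 9) ≤ 2 * C₁ * S * u := s1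
    have hb : m * σ * τ ≤ 8 * S * u := s4
    have hc : m * δ * τ ≤ 8 * S * u := by
      have h1 : m * δ ≤ m * σ := mul_le_mul_of_nonneg_left hδσ hm0
      have h2 : m * δ * τ ≤ m * σ * τ := mul_le_mul_of_nonneg_right h1 hτ0.le
      exact h2.trans hb
    have hd : σ ^ 2 * τ ≤ S ^ 2 * u := s2
    have he : σ * δ * τ ≤ S ^ 2 * u := by
      have h1 : σ * δ ≤ σ * σ := mul_le_mul_of_nonneg_left hδσ hσ0
      have h2 : σ * δ * τ ≤ σ * σ * τ := mul_le_mul_of_nonneg_right h1 hτ0.le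
      rw [← pow_two] at h2
      exact h2.trans hd
    have expand : 50 * δ * σ * (2 * ell D ^ 9) +
        ((2.3 * m + 5 * σ) * (σ + δ) + 5 * σ * σ) * (2 * τ) +
        2.3 * (2 * δ * σ) * (2 * ell D ^ 9) + (2.3 * m * (σ + δ) + 2.3 * σ * σ) * (2 * τ) =
        54.6 * (δ * σ * (2 * ell D ^ 9)) + 9.2 * (m * σ * τ) + 9.2 * (m * δ * τ) +
          24.6 * (σ ^ 2 * τ) + 10 * (σ * δ * τ) := by ring
    rw [expand]
    have hSu : 0 ≤ S * u := mul_nonneg hS0 hu0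
    have hCSu : 0 ≤ C₁ * S * u := mul_nonneg (mul_nonneg hC₁ hS0) hu0
    have hS2u : 0 ≤ S ^ 2 * u := mul_nonneg (sq_nonneg S) hu0
    linarith
  calc 2 * Real.exp 106 * (50 * δ * σ) * (1 + Real.log (Skeleton.P3 D / bigT D / Y₁)) +
        2 * Real.exp 106 * ((2.3 * m + 5 * σ) * (σ + δ) + 5 * σ * σ) * (1 + τ) +
        (2 * Real.exp 106 * (2.3 * (2 * δ * σ)) *
            (1 + Real.log (Skeleton.P2 D / bigT D / Skeleton.P3 D)) +
          2 * Real.exp 106 * (2.3 * m * (σ + δ) + 2.3 * σ * σ) * (1 + τ))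
      ≤ 2 * Real.exp 106 * (50 * δ * σ) * (2 * ell D ^ 9) +
        2 * Real.exp 106 * ((2.3 * m + 5 * σ) * (σ + δ) + 5 * σ * σ) * (2 * τ) +
        (2 * Real.exp 106 * (2.3 * (2 * δ * σ)) * (2 * ell D ^ 9) +
          2 * Real.exp 106 * (2.3 * m * (σ + δ) + 2.3 * σ * σ) * (2 * τ)) :=
        add_le_add
          (add_le_add (mul_le_mul_of_nonneg_left (by linarith) (mul_nonneg he106 hEI0))
            (mul_le_mul_of_nonneg_left (by linarith) (mul_nonneg he106 hEII0)))
          (add_le_add (mul_le_mul_of_nonneg_left (by linarith) (mul_nonneg he106 hEIII0))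
            (mul_le_mul_of_nonneg_left (by linarith) (mul_nonneg he106 hEIV0)))
    _ = 2 * Real.exp 106 * (50 * δ * σ * (2 * ell D ^ 9) +
        ((2.3 * m + 5 * σ) * (σ + δ) + 5 * σ * σ) * (2 * τ) +
        2.3 * (2 * δ * σ) * (2 * ell D ^ 9) + (2.3 * m * (σ + δ) + 2.3 * σ * σ) * (2 * τ)) := by
        ring
    _ ≤ 2 * Real.exp 106 * ((140 * C₁ * S + 200 * S + 40 * S ^ 2) * u) :=
        mul_le_mul_of_nonneg_left hJ (by positivity)
    _ = 2 * Real.exp 106 * (140 * C₁ * S + 200 * S + 40 * S ^ 2) * u := by ring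

end Top1225

end Literature.NumberTheory.LFunctions.Zhang2022.Typed.Sec12C
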